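import Literature.AlgebraicGeometry.Morphisms.FlatOfFlatFibresLocalBase
import Mathlib.RingTheory.Localization.BaseChange
import Mathlib.RingTheory.Localization.LocalizationLocalization
import Mathlib.RingTheory.FiniteStability
import Mathlib.RingTheory.LocalRing.ResidueField.Ideal
import Literature.AlgebraicGeometry.Limits.SurjectiveSpread
import Mathlib.AlgebraicGeometry.ResidueField
import Mathlib.AlgebraicGeometry.PullbackCarrier
import HarnessLib

/-!
# Flatness from flatness of the fibres over an ARBITRARY base (EGA IV₃ 11.3.10 / Stacks 039D, in full)

Topic `Literature/AlgebraicGeometry/Morphisms`, namespace `Literature.AlgebraicGeometry.Morphisms`.  THEOREMS ONLY (no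
definition, no named fact, no instance; net Literature debt 0).  Sequel of ★ `Morphisms/FlatOfFlatFibresLocalBase`, which
proves the critère de platitude par fibres at the CLOSED POINT of a LOCAL base (`flat_stalkMap_of_flat_closedFibre`, from the
tree's PROVED Tag 05UV `Literature.RingTheory.Flat.Stacks05UV_holds`).  This file removes both restrictions:

THE PRINT.  [EGAIV3] Thm. 11.3.10 / [StacksProject] Tag 039D («critère de platitude par fibres» for schemes): let `S` be a
scheme, `f : X → Y` a morphism of `S`-schemes with `X` flat and locally of finite presentation over `S` and `Y` locally of
finite type over `S`, `s ∈ S` a point; if the fibre `f_s : X_s → Y_s` is flat, then `f` is flat at every point of `X` over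
`s` (Tag 039D (1) ⇒ … at all `x ∈ X_s`); consequently ([StacksProject] Tag 039E) `f` is flat if all its fibres are.

WHAT IS HERE:
* §0 `flat_localization_of_flat_residueField_tensor` — Tag 05UV AT A PRIME `p` OF AN ARBITRARY RING `R`: `B` of finite type,
  `B'` finitely presented and flat over `R`, `q' ⊂ B'` a prime over `p`; if `κ(p) ⊗_R B → κ(p) ⊗_R B'` is flat then
  `B'_{q'}` is flat over `B` (base change to the local ring `R_p`, where `R_p ⊗_R B'` is the localisation of `B'` at the
  image of `R ∖ p` and `κ(p) ⊗_{R_p} (R_p ⊗_R -) = κ(p) ⊗_R -`, then ★ `Stacks05UV_holds` + ★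
  `flat_quotient_tensor_of_flat_tensor_map`, and `(R_p ⊗_R B')_{q'} = B'_{q'}`);
* §1 `flat_stalkMap_of_flat_fibre_of_isPullback` — AFFINE BASE `Spec R`, ANY POINT `p`, the fibre over `κ(p)` presented by
  ANY pair of cartesian squares: for `f : X → Y` over `Spec R` (`Y` lft, `X` flat lfp), `x ∈ X` over `p`, squares
  `X_p → X`, `Y_p → Y` over `Spec κ(p) → Spec R` and `f_p : X_p → Y_p` compatible with them, `Flat f_p` ⇒ the stalk map
  `𝒪_{Y, f x} → 𝒪_{X, x}` is flat (the ★ local-base chart argument with §0 in place of Tag 05UV and the prime of `x`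
  shown to lie EXACTLY over `p`);
* §2 **`flat_stalkMap_of_flat_fibre`** — ARBITRARY BASE `S`: for `f : X → Y` in `Over S` (same finiteness), `s ∈ S`, and
  the hypothesis «for every field `K` and every `t : Spec K → S` centred at `s`, the base change `X ×_S Spec K → Y ×_S Spec K`
  is flat», the stalk maps of `f` are flat at all points over `s` (restrict to an affine chart `Spec R₀ ⊆ S` through `s` —
  Mathlib `Scheme.affineCover` — where the fibre over `κ(s)` is a pasted pull-back, §1, and transport of stalk maps along the
  open immersion `X ×_S Spec R₀ → X`); the field-quantified hypothesis is implied by flatness of the single fibre over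
  `κ(s)` (`flat_pullback_of_flat_pullback_fromSpecResidueField`, Mathlib `Scheme.SpecToEquivOfField`), whence the printed
  form **`flat_stalkMap_of_flat_fibre_residueField`**;
* §3 **`flat_of_forall_flat_pullback_Spec_field`** / **`flat_of_forall_flat_fibre_residueField`** — Tag 039E: `f` is
  flat as soon as all its base changes to spectra of fields (resp. all its fibres `X ×_S Spec κ(s) → Y ×_S Spec κ(s)`) are
  flat (Mathlib `Flat.of_stalkMap`).

Cell `hodgecm-mathlib` (D-0151), `B-plan/F-census/SOCKETS-F.md` §3 N4-ét (the flat half of «`[N]` is étale on an abelian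
scheme», consumer ★-to-be `AbelianSchemes/AbelianSchemeOverMulNEtale`); prover seat B-p09 (g10), B-plan1 (g13) GO
2026-08-29T17:40:21Z.  COUNT-NEUTRAL capital: HC_CM is proved only modulo the 7 printed citations until rung 0 closes; this
file discharges none of them.

## References
* [EGAIV3] A. Grothendieck, J. Dieudonné, *EGA IV₃*, Publ. Math. IHÉS 28 (1966), Thm. 11.3.10.
* [StacksProject] The Stacks Project, Tags 00MP, 05UV (algebra), 039A–039E (schemes: «critère de platitude par fibres»),
  01JO (fibre products of affines).
* Tree: ★ `Morphisms/FlatOfFlatFibresLocalBase` (`flat_quotient_tensor_of_flat_tensor_map`, `flat_localRingHom_of_flat`,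
  local-base theorem), ★ `RingTheory/Flat/FibrewiseCriterionProofs` (`Stacks05UV_holds`), ★ `Morphisms/FibreChartRing`
  (`fibreChartIso`), ★ `Morphisms/SectionConormalChart` (`ChartRing`).
-/

noncomputable section

-- `TopCat.Presheaf` is not reducible (as in Mathlib's `AlgebraicGeometry/Modules` and the tree's
-- `Morphisms/FibreChartRing`, whose charts are used below).
set_option backward.isDefEq.respectTransparency false

open TensorProduct IsLocalRing CategoryTheory CategoryTheory.Limits AlgebraicGeometry

universe u

namespace Literature.AlgebraicGeometry.Morphisms

/-! ## §0 Tag 05UV at a prime of an arbitrary base ring -/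

section Algebra

variable {R B B' : Type u} [CommRing R] [CommRing B] [CommRing B'] [Algebra R B] [Algebra R B'] [Algebra B B']
  [IsScalarTower R B B']

/-- **Critère de platitude par fibres at a prime of an arbitrary ring** ([StacksProject, Tag 05UV] over the local ring
`R_p`; [EGAIV3, 11.3.10]).  Let `R` be a commutative ring, `p ⊂ R` a prime, `B` an `R`-algebra of finite type, `B'` a
finitely presented flat `R`-algebra with an `R`-algebra map `B → B'`, and `q' ⊂ B'` a prime lying over `p`.  If the fibre map
`κ(p) ⊗_R B → κ(p) ⊗_R B'` is flat, then `B'_{q'}` is flat over `B`.  Proof: base-change to `R_p` — `R_p ⊗_R B` is of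
finite type, `R_p ⊗_R B'` finitely presented and flat over the LOCAL ring `R_p`, and `κ(p) ⊗_{R_p} (R_p ⊗_R -) = κ(p) ⊗_R -`
(Mathlib `Algebra.TensorProduct.cancelBaseChange`), so the tree's Tag 05UV (★ `Stacks05UV_holds`, via ★
`flat_quotient_tensor_of_flat_tensor_map`) makes `(R_p ⊗_R B')_{q'_p}` flat over `R_p ⊗_R B`, where `q'_p` is the extension
of `q'` to the localisation `R_p ⊗_R B' = (R∖p)⁻¹B'` (Mathlib `IsLocalization.tensorRight`); finally `B → R_p ⊗_R B` is
flat (a localisation) and `(R_p ⊗_R B')_{q'_p} = B'_{q'}` (Mathlib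
`IsLocalization.isLocalization_isLocalization_atPrime_isLocalization`). [cite: StacksProject, Tag 05UV] [cite: EGAIV3, Thm. 11.3.10] -/
theorem flat_localization_of_flat_residueField_tensor [Algebra.FiniteType R B] [Algebra.FinitePresentation R B']
    [Module.Flat R B'] (p : Ideal R) [p.IsPrime]
    (h : (Algebra.TensorProduct.map (AlgHom.id R p.ResidueField)
      (IsScalarTower.toAlgHom R B B')).toRingHom.Flat)
    (q' : Ideal B') [q'.IsPrime] (hq' : q'.comap (algebraMap R B') = p) :
    Module.Flat B (Localization.AtPrime q') := by
  classical
  set Rp := Localization.AtPrime p with hRp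
  set κ := p.ResidueField with hκ
  set g : B →ₐ[R] B' := IsScalarTower.toAlgHom R B B' with hg
  let gp : Rp ⊗[R] B →ₐ[Rp] Rp ⊗[R] B' := Algebra.TensorProduct.map (AlgHom.id Rp Rp) g
  letI algp : Algebra (Rp ⊗[R] B) (Rp ⊗[R] B') := gp.toRingHom.toAlgebra
  haveI : IsScalarTower Rp (Rp ⊗[R] B) (Rp ⊗[R] B') :=
    IsScalarTower.of_algebraMap_eq fun r => (gp.commutes r).symm
  have hgp : IsScalarTower.toAlgHom Rp (Rp ⊗[R] B) (Rp ⊗[R] B') = gp := AlgHom.ext fun _ => rfl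
  have hker : maximalIdeal Rp = RingHom.ker (algebraMap Rp κ) := (Ideal.mk_ker (I := maximalIdeal Rp)).symm
  let e : (Rp ⧸ maximalIdeal Rp) ≃ₐ[Rp] κ :=
    (Ideal.quotientEquivAlgOfEq Rp hker).trans
      (Ideal.quotientKerAlgEquivOfSurjective (f := Algebra.ofId Rp κ) (IsLocalRing.residue_surjective))
  -- the fibre hypothesis over `R_p` (from the one over `R`, via `cancelBaseChange`) in Tag 05UV's quotient form
  have hfib := flat_quotient_tensor_of_flat_tensor_map (R := Rp) (κ := κ) (B := Rp ⊗[R] B)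
    (B' := Rp ⊗[R] B') (maximalIdeal Rp) e (by
      rw [hgp]
      let φ₀ : κ ⊗[R] B →ₐ[Rp] κ ⊗[R] B' := Algebra.TensorProduct.map (AlgHom.id Rp κ) g
      let eB := Algebra.TensorProduct.cancelBaseChange R Rp Rp κ B
      let eB' := Algebra.TensorProduct.cancelBaseChange R Rp Rp κ B'
      have h₀ : φ₀.toRingHom.Flat := h
      have heq : Algebra.TensorProduct.map (AlgHom.id Rp κ) gp =
          (eB'.symm.toAlgHom.comp φ₀).comp eB.toAlgHom := by
        apply Algebra.TensorProduct.ext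
        · ext a
          simp [φ₀, eB, eB', gp, Algebra.TensorProduct.one_def]
        · apply Algebra.TensorProduct.ext
          all_goals (ext <;> simp [φ₀, eB, eB', gp, g])
      rw [heq]
      change ((eB'.symm.toRingEquiv.toRingHom.comp φ₀.toRingHom).comp eB.toRingEquiv.toRingHom).Flat
      exact RingHom.Flat.comp (.of_bijective eB.toRingEquiv.bijective)
        (RingHom.Flat.comp h₀ (.of_bijective eB'.symm.toRingEquiv.bijective)))
  -- the prime `q'_p ⊂ B'_p = R_p ⊗_R B'` above `q'`
  letI algB' : Algebra B' (Rp ⊗[R] B') := Algebra.TensorProduct.rightAlgebra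
  letI algB : Algebra B (Rp ⊗[R] B) := Algebra.TensorProduct.rightAlgebra
  set M' := Algebra.algebraMapSubmonoid B' p.primeCompl with hM'
  haveI hlocB' : IsLocalization M' (Rp ⊗[R] B') := IsLocalization.tensorRight (R := R) (S := B') Rp p.primeCompl
  haveI hlocB : IsLocalization (Algebra.algebraMapSubmonoid B p.primeCompl) (Rp ⊗[R] B) :=
    IsLocalization.tensorRight (R := R) (S := B) Rp p.primeCompl
  have hdisj : Disjoint (M' : Set B') (q' : Set B') := by
    rw [Set.disjoint_left]
    rintro _ ⟨r, hr, rfl⟩ hrq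
    exact hr (hq'.le (Ideal.mem_comap.mpr hrq))
  set q'p : Ideal (Rp ⊗[R] B') := q'.map (algebraMap B' (Rp ⊗[R] B')) with hq'p
  haveI : q'p.IsPrime := IsLocalization.isPrime_of_isPrime_disjoint M' _ q' ‹_› hdisj
  have hcomap : q'p.comap (algebraMap B' (Rp ⊗[R] B')) = q' :=
    IsLocalization.under_map_of_isPrime_disjoint M' (Rp ⊗[R] B') ‹q'.IsPrime› hdisj
  have hle : (maximalIdeal Rp).map (algebraMap Rp (Rp ⊗[R] B')) ≤ q'p := by
    rw [← Localization.AtPrime.map_eq_maximalIdeal, Ideal.map_map, ← IsScalarTower.algebraMap_eq,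
      IsScalarTower.algebraMap_eq R B' (Rp ⊗[R] B'), ← Ideal.map_map]
    exact Ideal.map_mono (Ideal.map_le_iff_le_comap.mpr hq'.ge)
  -- Tag 05UV over the local ring `R_p`
  have h05 := Literature.RingTheory.Flat.Stacks05UV_holds Rp (Rp ⊗[R] B) (Rp ⊗[R] B')
    inferInstance inferInstance inferInstance hfib q'p hle
  -- `B → B_p → (B'_p)_{q'_p}` is flat
  letI algBL : Algebra B (Localization.AtPrime q'p) :=
    ((algebraMap (Rp ⊗[R] B) (Localization.AtPrime q'p)).comp (algebraMap B (Rp ⊗[R] B))).toAlgebra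
  haveI : IsScalarTower B (Rp ⊗[R] B) (Localization.AtPrime q'p) := IsScalarTower.of_algebraMap_eq fun _ => rfl
  haveI : Module.Flat B (Rp ⊗[R] B) := IsLocalization.flat (Rp ⊗[R] B) (Algebra.algebraMapSubmonoid B p.primeCompl)
  have hflatL : Module.Flat B (Localization.AtPrime q'p) := Module.Flat.trans B (Rp ⊗[R] B) _
  -- `(B'_p)_{q'_p} = B'_{q'}` as `B'`-algebras, compatibly with `B`
  haveI : IsScalarTower B B' (Localization.AtPrime q'p) := by
    refine IsScalarTower.of_algebraMap_eq fun b => ?_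
    change algebraMap (Rp ⊗[R] B) (Localization.AtPrime q'p) ((1 : Rp) ⊗ₜ[R] b) = _
    rw [IsScalarTower.algebraMap_apply B' (Rp ⊗[R] B') (Localization.AtPrime q'p),
      IsScalarTower.algebraMap_apply (Rp ⊗[R] B) (Rp ⊗[R] B') (Localization.AtPrime q'p)]
    exact congrArg (algebraMap (Rp ⊗[R] B') (Localization.AtPrime q'p))
      (show gp ((1 : Rp) ⊗ₜ[R] b) = (1 : Rp) ⊗ₜ[R] (algebraMap B B' b) by
        rw [Algebra.TensorProduct.map_tmul]; rfl)
  haveI hlocL : IsLocalization.AtPrime (Localization.AtPrime q'p) q' := by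
    have hL := IsLocalization.isLocalization_isLocalization_atPrime_isLocalization M'
      (Localization.AtPrime q'p) q'p
    have hS : (q'p.comap (algebraMap B' (Rp ⊗[R] B'))).primeCompl = q'.primeCompl :=
      Submonoid.ext fun x => by
        change x ∉ q'p.comap (algebraMap B' (Rp ⊗[R] B')) ↔ x ∉ q'
        rw [hcomap]
    change IsLocalization q'.primeCompl (Localization.AtPrime q'p)
    rw [← hS]
    exact hL
  exact Module.Flat.of_linearEquiv
    ((IsLocalization.algEquiv q'.primeCompl (Localization.AtPrime q')
      (Localization.AtPrime q'p)).toLinearEquiv.restrictScalars B)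

end Algebra

/-! ## §1 Affine base, any point, any presentation of the fibre -/

/-- `appLE` along an equality of morphisms (bookkeeping). [folklore] -/
private theorem appLE_congr' {X Y : Scheme.{u}} {f g : X ⟶ Y} (h : f = g) (U : Y.Opens) (V : X.Opens)
    (e : V ≤ f ⁻¹ᵁ U) : f.appLE U V e = g.appLE U V (h ▸ e) := by
  subst h; rfl

open ChartRing in
/-- **Critère de platitude par fibres over an affine base, at any point** ([EGAIV3] Thm. 11.3.10; [StacksProject] Tag 039D,
from the algebra §0).  Let `R` be a ring, `X`, `Y` schemes over `Spec R` with `Y` locally of finite type and `X` flat and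
locally of finite presentation over `R`, `f : X → Y` an `R`-morphism, `p ∈ Spec R`, and let the fibres over `κ(p)` be presented
by ANY cartesian squares `(p_X, t_X)`, `(p_Y, t_Y)` over `Spec κ(p) → Spec R` together with a morphism `f_p : X_p → Y_p`
compatible with them (`f_p ≫ p_Y = p_X ≫ f`, `f_p ≫ t_Y = t_X`).  If `f_p` is flat, then for every point `x` of `X` over `p` the
stalk map `𝒪_{Y, f x} → 𝒪_{X, x}` is flat.  Proof = the chart argument of ★ `flat_stalkMap_of_flat_closedFibre`: affine opens
`f x ∈ V = Spec B`, `x ∈ U = Spec B' ⊆ f⁻¹V`; the fibre charts `κ(p) ⊗_R B → κ(p) ⊗_R B'` (★ `fibreChartIso`) are flat; the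
prime `q'` of `x` lies exactly over `p` (germs of sections of `Spec R` at `p`); §0 gives `B'_{q'}` flat over `B`, i.e. the
stalk map is flat (Mathlib `IsAffineOpen.arrowStalkMapIso`). [cite: EGAIV3, Thm. 11.3.10] [cite: StacksProject, Tag 05UV] -/
theorem flat_stalkMap_of_flat_fibre_of_isPullback {R : Type u} [CommRing R]
    {X Y : Over (Spec (CommRingCat.of R))} (f : X ⟶ Y)
    [LocallyOfFiniteType Y.hom] [LocallyOfFinitePresentation X.hom] [Flat X.hom]
    (p : Spec (CommRingCat.of R)) {Xs Ys : Scheme.{u}}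
    {pX : Xs ⟶ X.left} {tX : Xs ⟶ Spec (.of p.asIdeal.ResidueField)}
    (hPX : IsPullback pX tX X.hom (Spec.map (CommRingCat.ofHom (algebraMap R p.asIdeal.ResidueField))))
    {pY : Ys ⟶ Y.left} {tY : Ys ⟶ Spec (.of p.asIdeal.ResidueField)}
    (hPY : IsPullback pY tY Y.hom (Spec.map (CommRingCat.ofHom (algebraMap R p.asIdeal.ResidueField))))
    (fs : Xs ⟶ Ys) (hfs₁ : fs ≫ pY = pX ≫ f.left) (hfs₂ : fs ≫ tY = tX) [Flat fs]
    (x : X.left) (hx : X.hom x = p) : (f.left.stalkMap x).hom.Flat := by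
  have hw : f.left ≫ Y.hom = X.hom := Over.w f
  -- affine opens `f x ∈ V ⊆ Y`, `x ∈ U ⊆ f⁻¹ V`
  obtain ⟨_, ⟨V, hV, rfl⟩, hyV, -⟩ :=
    Y.left.isBasis_affineOpens.exists_subset_of_mem_open (Set.mem_univ (f.left x)) isOpen_univ
  obtain ⟨_, ⟨U, hU, rfl⟩, hxU, hUV⟩ :=
    X.left.isBasis_affineOpens.exists_subset_of_mem_open (show x ∈ (f.left ⁻¹ᵁ V : Set X.left) from hyV)
      (f.left ⁻¹ᵁ V).isOpen
  have hV : IsAffineOpen V := hV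
  have hU : IsAffineOpen U := hU
  have hUV : U ≤ f.left ⁻¹ᵁ V := hUV
  -- the coordinate rings as `R`-algebras and the map `g = f^♯ : B → B'`
  have happ : Y.hom.appLE ⊤ V le_top ≫ f.left.appLE V U hUV = X.hom.appLE ⊤ U le_top := by
    have key : ∀ {g : X.left ⟶ Spec (.of R)} (h : f.left ≫ Y.hom = g) (e : U ≤ (f.left ≫ Y.hom) ⁻¹ᵁ ⊤),
        (f.left ≫ Y.hom).appLE ⊤ U e = g.appLE ⊤ U (h ▸ e) := by
      intro g h e; subst h; rfl
    rw [Scheme.Hom.appLE_comp_appLE]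
    exact key hw _
  letI algBB' : Algebra (ChartRing Y.hom V) (ChartRing X.hom U) :=
    ((ChartRing.mk X.hom U).comp ((f.left.appLE V U hUV).hom.comp ChartRing.val)).toAlgebra
  haveI : IsScalarTower R (ChartRing Y.hom V) (ChartRing X.hom U) :=
    IsScalarTower.of_algebraMap_eq fun r => ChartRing.val_injective X.hom U (by
      change _ = f.left.appLE V U hUV (ChartRing.val (algebraMap R (ChartRing Y.hom V) r))
      rw [ChartRing.val_algebraMap, ChartRing.val_algebraMap, ← happ]
      rfl)
  -- finiteness / flatness hypotheses of Tag 05UV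
  haveI hFT : Algebra.FiniteType R (ChartRing Y.hom V) := by
    have h1 : (Y.hom.appLE ⊤ V le_top).hom.FiniteType :=
      HasRingHomProperty.appLE @LocallyOfFiniteType Y.hom inferInstance ⟨⊤, isAffineOpen_top _⟩
        ⟨V, hV⟩ le_top
    rw [← RingHom.finiteType_algebraMap]
    exact (RingHom.finiteType_respectsIso.cancel_left_isIso (Scheme.ΓSpecIso (.of R)).inv
      (Y.hom.appLE ⊤ V le_top)).mpr h1
  haveI hFP : Algebra.FinitePresentation R (ChartRing X.hom U) := by
    have h1 : (X.hom.appLE ⊤ U le_top).hom.FinitePresentation :=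
      HasRingHomProperty.appLE @LocallyOfFinitePresentation X.hom inferInstance
        ⟨⊤, isAffineOpen_top _⟩ ⟨U, hU⟩ le_top
    rw [← RingHom.finitePresentation_algebraMap]
    exact (RingHom.finitePresentation_respectsIso.cancel_left_isIso (Scheme.ΓSpecIso (.of R)).inv
      (X.hom.appLE ⊤ U le_top)).mpr h1
  haveI hFl : Module.Flat R (ChartRing X.hom U) := by
    have h1 : (X.hom.appLE ⊤ U le_top).hom.Flat :=
      HasRingHomProperty.appLE @Flat X.hom inferInstance ⟨⊤, isAffineOpen_top _⟩ ⟨U, hU⟩ le_top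
    rw [← RingHom.flat_algebraMap_iff]
    exact (RingHom.Flat.respectsIso.cancel_left_isIso (Scheme.ΓSpecIso (.of R)).inv
      (X.hom.appLE ⊤ U le_top)).mpr h1
  -- the fibre square on the charts
  have hUs : IsAffineOpen (pX ⁻¹ᵁ U) := isAffineOpen_preimage_of_isPullback X.hom pX tX hPX hU
  have hVs : IsAffineOpen (pY ⁻¹ᵁ V) := isAffineOpen_preimage_of_isPullback Y.hom pY tY hPY hV
  have hle : pX ⁻¹ᵁ U ≤ fs ⁻¹ᵁ (pY ⁻¹ᵁ V) := by
    rw [← Scheme.Hom.comp_preimage, hfs₁, Scheme.Hom.comp_preimage]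
    exact fun z hz => hUV hz
  -- flatness of the fibre map on the charts, transported to `κ ⊗ B → κ ⊗ B'`
  have hflat_s : (fs.appLE (pY ⁻¹ᵁ V) (pX ⁻¹ᵁ U) hle).hom.Flat :=
    HasRingHomProperty.appLE @Flat fs inferInstance ⟨_, hVs⟩ ⟨_, hUs⟩ hle
  let eX := fibreChartIso X.hom pX tX hPX hU
  let eY := fibreChartIso Y.hom pY tY hPY hV
  let g : ChartRing Y.hom V →ₐ[R] ChartRing X.hom U := IsScalarTower.toAlgHom R _ _
  have hconst : ∀ a : p.asIdeal.ResidueField, fs.appLE _ _ hle (fibreConst pY tY V a) = fibreConst pX tX U a := by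
    intro a
    rw [fibreConst_apply, fibreConst_apply, ← CommRingCat.comp_apply (tY.appLE ⊤ _ le_top),
      Scheme.Hom.appLE_comp_appLE, appLE_congr' hfs₂]
  have hsect : ∀ b : ChartRing Y.hom V,
      fs.appLE _ _ hle (pY.app V (ChartRing.val b)) = pX.app U (ChartRing.val (g b)) := by
    intro b
    have hc : (pX ≫ f.left).appLE V (pX ⁻¹ᵁ U)
        (by rw [Scheme.Hom.comp_preimage]; exact fun z hz => hUV hz) =
        f.left.appLE V U hUV ≫ pX.appLE U (pX ⁻¹ᵁ U) le_rfl :=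
      (Scheme.Hom.appLE_comp_appLE _ _ _ _ _ _ _).symm
    rw [Scheme.Hom.app_eq_appLE, Scheme.Hom.app_eq_appLE, ← CommRingCat.comp_apply (pY.appLE V _ _),
      Scheme.Hom.appLE_comp_appLE, appLE_congr' hfs₁, hc]
    rfl
  have hsq : ∀ z, fs.appLE _ _ hle (eY z) = eX (Algebra.TensorProduct.map (AlgHom.id R p.asIdeal.ResidueField) g z) := by
    intro z
    induction z using TensorProduct.induction_on with
    | zero => simp only [map_zero]
    | add x y hx hy => simp only [map_add, hx, hy]
    | tmul a b =>
      rw [Algebra.TensorProduct.map_tmul, AlgHom.id_apply, fibreChartIso_tmul, fibreChartIso_tmul,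
        map_mul, hconst, hsect]
  have hflatg : (Algebra.TensorProduct.map (AlgHom.id R p.asIdeal.ResidueField) g).toRingHom.Flat := by
    have heq : (Algebra.TensorProduct.map (AlgHom.id R p.asIdeal.ResidueField) g).toRingHom =
        eX.symm.toRingHom.comp ((fs.appLE _ _ hle).hom.comp eY.toRingHom) := by
      refine RingHom.ext fun z => ?_
      simp only [RingHom.comp_apply, AlgHom.toRingHom_eq_coe, RingHom.coe_coe,
        RingEquiv.toRingHom_eq_coe, hsq, RingEquiv.symm_apply_apply]
    rw [heq]
    exact (RingHom.Flat.comp (RingHom.Flat.comp (.of_bijective eY.bijective) hflat_s)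
      (.of_bijective eX.symm.bijective))
  -- the prime `q'` of `x` in `B' = Γ(X, U)` lies EXACTLY over `p`
  have hq : ((hU.primeIdealOf ⟨x, hxU⟩).asIdeal).comap (algebraMap R (ChartRing X.hom U)) = p.asIdeal := by
    ext r
    rw [Ideal.mem_comap]
    change (Scheme.ΓSpecIso (.of R)).inv r ∈
        ((hU.primeIdealOf ⟨x, hxU⟩).comap (X.hom.appLE ⊤ U le_top).hom).asIdeal ↔ r ∈ p.asIdeal
    rw [IsAffineOpen.comap_primeIdealOf_appLE ⊤ (isAffineOpen_top _) U hU le_top hxU]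
    have hxt : X.hom x ∈ (⊤ : (Spec (CommRingCat.of R)).Opens) := (le_top : U ≤ X.hom ⁻¹ᵁ ⊤) hxU
    letI := (Spec (CommRingCat.of R)).presheaf.algebra_section_stalk
      (⟨X.hom x, hxt⟩ : (⊤ : (Spec (CommRingCat.of R)).Opens))
    haveI := (isAffineOpen_top (Spec (CommRingCat.of R))).isLocalization_stalk ⟨X.hom x, hxt⟩
    rw [← IsLocalization.AtPrime.to_map_mem_maximal_iff
      ((Spec (CommRingCat.of R)).presheaf.stalk (X.hom x))
      ((isAffineOpen_top (Spec (CommRingCat.of R))).primeIdealOf ⟨X.hom x, hxt⟩).asIdeal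
      ((Scheme.ΓSpecIso (.of R)).inv r), IsLocalRing.mem_maximalIdeal, mem_nonunits_iff]
    change ¬ IsUnit ((Spec (CommRingCat.of R)).presheaf.germ ⊤ (X.hom x) hxt
      ((Scheme.ΓSpecIso (.of R)).inv r)) ↔ _
    rw [← Scheme.mem_basicOpen, basicOpen_eq_of_affine, hx, PrimeSpectrum.mem_basicOpen, not_not]
  -- §0: `B'_{q'}` is flat over `B`
  have h05 := flat_localization_of_flat_residueField_tensor (B := ChartRing Y.hom V) (B' := ChartRing X.hom U)
    p.asIdeal hflatg _ hq
  -- transport to the stalk map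
  have hloc := flat_localRingHom_of_flat (B := ChartRing Y.hom V) (B' := ChartRing X.hom U)
    (hU.primeIdealOf ⟨x, hxU⟩).asIdeal (hV.primeIdealOf ⟨f.left x, hUV hxU⟩).asIdeal
    (congr($(IsAffineOpen.comap_primeIdealOf_appLE V hV U hU hUV hxU).1).symm) h05
  haveI := RingHom.toMorphismProperty_respectsIso_iff.mp RingHom.Flat.respectsIso
  exact (MorphismProperty.arrow_mk_iso_iff (RingHom.toMorphismProperty RingHom.Flat)
    (IsAffineOpen.arrowStalkMapIso f.left V hV U hU hUV hxU)).mpr hloc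

/-! ## §2 Arbitrary base -/

section GeneralBase

variable {S : Scheme.{u}}

/-- The comparison map `X ×_S T' → X ×_S T` over `a : T' → T` (for `X → S` and `T → S`): the lift of
`(pr_X, pr_{T'} ≫ a)`. Bookkeeping: its two defining identities. [folklore] -/
private theorem lift_fst_snd_comp {T T' : Scheme.{u}} (a : T' ⟶ T) (b : T ⟶ S) (X : Over S) :
    pullback.lift (pullback.fst X.hom (a ≫ b)) (pullback.snd X.hom (a ≫ b) ≫ a)
        (by rw [pullback.condition, Category.assoc]) ≫ pullback.fst X.hom b = pullback.fst X.hom (a ≫ b) ∧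
      pullback.lift (pullback.fst X.hom (a ≫ b)) (pullback.snd X.hom (a ≫ b) ≫ a)
        (by rw [pullback.condition, Category.assoc]) ≫ pullback.snd X.hom b = pullback.snd X.hom (a ≫ b) ≫ a :=
  ⟨pullback.lift_fst _ _ _, pullback.lift_snd _ _ _⟩

/-- **`X ×_S T' = (X ×_S T) ×_T T'`** (transitivity of base change, [GortzWedhorn2020] (4.7)): the comparison map
`X ×_S T' → X ×_S T` and the projection to `T'` form a cartesian square over `a : T' → T` (pasting, Mathlib
`IsPullback.of_right`). [cite: GortzWedhorn2020, Section (4.7) (pp. 107–108)] -/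
theorem isPullback_lift_snd_of_comp {T T' : Scheme.{u}} (a : T' ⟶ T) (b : T ⟶ S) (X : Over S) :
    IsPullback (pullback.lift (pullback.fst X.hom (a ≫ b)) (pullback.snd X.hom (a ≫ b) ≫ a)
        (by rw [pullback.condition, Category.assoc]))
      (pullback.snd X.hom (a ≫ b)) (pullback.snd X.hom b) a := by
  refine IsPullback.of_right ?_ (lift_fst_snd_comp a b X).2 (IsPullback.of_hasPullback X.hom b)
  rw [(lift_fst_snd_comp a b X).1]
  exact IsPullback.of_hasPullback X.hom (a ≫ b)

/-- **The base change of `f` along `T' → T → S` is the base change along `T' → T` of the base change along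
`T → S`**: the square `(f_{T'}, X ×_S T' → X ×_S T; Y ×_S T' → Y ×_S T, f_T)` is cartesian (vertical pasting over
★ `isPullback_pullback_map_left`). [cite: GortzWedhorn2020, Section (4.7) (pp. 107–108)] -/
theorem isPullback_pullback_map_left_of_comp {T T' : Scheme.{u}} (a : T' ⟶ T) (b : T ⟶ S) {X Y : Over S}
    (f : X ⟶ Y) :
    IsPullback ((Over.pullback (a ≫ b)).map f).left
      (pullback.lift (pullback.fst X.hom (a ≫ b)) (pullback.snd X.hom (a ≫ b) ≫ a)
        (by rw [pullback.condition, Category.assoc]))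
      (pullback.lift (pullback.fst Y.hom (a ≫ b)) (pullback.snd Y.hom (a ≫ b) ≫ a)
        (by rw [pullback.condition, Category.assoc]))
      ((Over.pullback b).map f).left := by
  have hX := lift_fst_snd_comp a b X
  have hY := lift_fst_snd_comp a b Y
  have hft₁ : ((Over.pullback (a ≫ b)).map f).left ≫ pullback.fst Y.hom (a ≫ b) =
      pullback.fst X.hom (a ≫ b) ≫ f.left := pullback.lift_fst _ _ _
  have hft₂ : ((Over.pullback (a ≫ b)).map f).left ≫ pullback.snd Y.hom (a ≫ b) = pullback.snd X.hom (a ≫ b) :=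
    Over.w _
  have hfb₁ : ((Over.pullback b).map f).left ≫ pullback.fst Y.hom b = pullback.fst X.hom b ≫ f.left :=
    pullback.lift_fst _ _ _
  have hfb₂ : ((Over.pullback b).map f).left ≫ pullback.snd Y.hom b = pullback.snd X.hom b := Over.w _
  refine IsPullback.of_bot ?_ ?_ (Literature.AlgebraicGeometry.Limits.isPullback_pullback_map_left b f)
  · rw [hX.1, hY.1]
    exact Literature.AlgebraicGeometry.Limits.isPullback_pullback_map_left (a ≫ b) f
  · apply pullback.hom_ext
    · rw [Category.assoc, hY.1, hft₁, Category.assoc, hfb₁, ← Category.assoc, hX.1]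
    · rw [Category.assoc, hY.2, ← Category.assoc, hft₂, Category.assoc, hfb₂, hX.2]

/-- **Flatness over an open part of the base, pointwise**: for an open immersion `g : S' → S` and `f : X → Y` over `S`, if
the stalk map of the base change `X ×_S S' → Y ×_S S'` at `x'` is flat then so is the stalk map of `f` at the image of `x'`
(the projections `X ×_S S' → X`, `Y ×_S S' → Y` are open immersions, so their stalk maps are isomorphisms; pointwise form
of the private lemma of ★ `FlatOfFlatFibresLocalBase`). [folklore] -/
private theorem flat_stalkMap_of_flat_stalkMap_pullback_of_isOpenImmersion {S' : Scheme.{u}} (g : S' ⟶ S)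
    [IsOpenImmersion g] {X Y : Over S} (f : X ⟶ Y) (x' : ↥(pullback X.hom g))
    (h : ((((Over.pullback g).map f).left).stalkMap x').hom.Flat) :
    (f.left.stalkMap (pullback.fst X.hom g x')).hom.Flat := by
  have hfs₁ : ((Over.pullback g).map f).left ≫ pullback.fst Y.hom g = pullback.fst X.hom g ≫ f.left :=
    pullback.lift_fst _ _ _
  -- `(f_{S'} ≫ pr_Y)^♯_{x'} = f_{S'}^♯_{x'} ∘ (pr_Y)^♯` is flat (`pr_Y` is an open immersion)
  have h1 : ((((Over.pullback g).map f).left ≫ pullback.fst Y.hom g).stalkMap x').hom.Flat := by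
    rw [Scheme.Hom.stalkMap_comp, CommRingCat.hom_comp]
    exact (RingHom.Flat.of_bijective (ConcreteCategory.bijective_of_isIso _)).comp h
  -- hence so is `(pr_X ≫ f)^♯_{x'} = (pr_X)^♯_{x'} ∘ f^♯_{pr_X x'}`
  have h2 : ((pullback.fst X.hom g ≫ f.left).stalkMap x').hom.Flat := by
    rw [Scheme.Hom.stalkMap_congr_hom _ _ hfs₁.symm x', CommRingCat.hom_comp]
    exact (RingHom.Flat.of_bijective (ConcreteCategory.bijective_of_isIso _)).comp h1
  -- and `(pr_X)^♯_{x'}` is invertible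
  have h3 : f.left.stalkMap (pullback.fst X.hom g x') =
      (pullback.fst X.hom g ≫ f.left).stalkMap x' ≫ inv ((pullback.fst X.hom g).stalkMap x') := by
    rw [Scheme.Hom.stalkMap_comp, Category.assoc, IsIso.hom_inv_id, Category.comp_id]
  rw [h3, CommRingCat.hom_comp]
  exact h2.comp (RingHom.Flat.of_bijective (ConcreteCategory.bijective_of_isIso _))

/-- The canonical point `Spec κ(p) → Spec R` lands at `p`. [folklore] -/
private theorem specMap_algebraMap_residueField_apply {R : CommRingCat.{u}} (p : Spec R)
    (y : Spec (.of p.asIdeal.ResidueField)) :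
    Spec.map (CommRingCat.ofHom (algebraMap R p.asIdeal.ResidueField)) y = p := by
  apply PrimeSpectrum.ext
  rw [Spec.map_apply, PrimeSpectrum.comap_asIdeal, CommRingCat.hom_ofHom, Ideal.eq_bot_of_prime y.asIdeal,
    ← RingHom.ker_eq_comap_bot, Ideal.ker_algebraMap_residueField]

/-- **CRITÈRE DE PLATITUDE PAR FIBRES OVER AN ARBITRARY BASE** ([EGAIV3] Thm. 11.3.10; [StacksProject] Tag 039D).  Let `S`
be a scheme, `f : X → Y` a morphism of `S`-schemes with `X` flat and locally of finite presentation over `S` and `Y` locally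
of finite type over `S`, and `s ∈ S`.  Suppose that for every field `K` and every `t : Spec K → S` centred at `s` the base
change `X ×_S Spec K → Y ×_S Spec K` of `f` is flat (equivalently — `flat_stalkMap_of_flat_fibre_residueField` — the fibre
`X ×_S Spec κ(s) → Y ×_S Spec κ(s)` is flat).  Then the stalk map `𝒪_{Y, f x} → 𝒪_{X, x}` is flat at every point `x` of `X`
over `s`.  Proof: choose an affine open `Spec R₀ ≅ W ∋ s` (Mathlib `IsAffineOpen.fromSpec`); over it the fibre over `κ(s)`
of the restricted morphism `X ×_S Spec R₀ → Y ×_S Spec R₀` is the pasted base change along `Spec κ(r) → Spec R₀ → S`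
(`isPullback_lift_snd_of_comp`, `isPullback_pullback_map_left_of_comp`), so §1 applies at a point over `x`; the stalk maps of
`f` and of its restriction agree (`flat_stalkMap_of_flat_stalkMap_pullback_of_isOpenImmersion`).
[cite: EGAIV3, Thm. 11.3.10] [cite: StacksProject, Tag 05UV] -/
theorem flat_stalkMap_of_flat_fibre {X Y : Over S} (f : X ⟶ Y)
    [LocallyOfFiniteType Y.hom] [LocallyOfFinitePresentation X.hom] [Flat X.hom] (s : S)
    (hfib : ∀ (K : Type u) [Field K] (t : Spec (.of K) ⟶ S), t (IsLocalRing.closedPoint K) = s →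
      Flat ((Over.pullback t).map f).left)
    (x : X.left) (hx : X.hom x = s) : (f.left.stalkMap x).hom.Flat := by
  -- an affine chart `ι : Spec R₀ → S` through `s`
  obtain ⟨_, ⟨W, hW, rfl⟩, hsW, -⟩ :=
    S.isBasis_affineOpens.exists_subset_of_mem_open (Set.mem_univ s) isOpen_univ
  have hW : IsAffineOpen W := hW
  have hιr : hW.fromSpec (hW.primeIdealOf ⟨s, hsW⟩) = s := hW.fromSpec_primeIdealOf ⟨s, hsW⟩
  -- a point `x₁` of `X ×_S Spec R₀` over `x` and over `r = the prime of s`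
  obtain ⟨x₁, hx₁, hx₁r⟩ := Scheme.Pullback.exists_preimage_pullback (f := X.hom) (g := hW.fromSpec) x
    (hW.primeIdealOf ⟨s, hsW⟩) (by rw [hx, hιr])
  -- the fibre over `κ(r)` as the base change along `t : Spec κ(r) → Spec R₀ → S`
  haveI := hfib _ (Spec.map (CommRingCat.ofHom (algebraMap Γ(S, W) (hW.primeIdealOf ⟨s, hsW⟩).asIdeal.ResidueField)) ≫
    hW.fromSpec) (by
      rw [Scheme.Hom.comp_apply, specMap_algebraMap_residueField_apply]; exact hιr)
  haveI : LocallyOfFiniteType ((Over.pullback hW.fromSpec).obj Y).hom :=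
    inferInstanceAs (LocallyOfFiniteType (pullback.snd Y.hom hW.fromSpec))
  haveI : LocallyOfFinitePresentation ((Over.pullback hW.fromSpec).obj X).hom :=
    inferInstanceAs (LocallyOfFinitePresentation (pullback.snd X.hom hW.fromSpec))
  haveI : Flat ((Over.pullback hW.fromSpec).obj X).hom := inferInstanceAs (Flat (pullback.snd X.hom hW.fromSpec))
  have h₁ := flat_stalkMap_of_flat_fibre_of_isPullback (R := Γ(S, W)) ((Over.pullback hW.fromSpec).map f)
    (hW.primeIdealOf ⟨s, hsW⟩)
    (isPullback_lift_snd_of_comp (Spec.map (CommRingCat.ofHom (algebraMap Γ(S, W)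
      (hW.primeIdealOf ⟨s, hsW⟩).asIdeal.ResidueField))) hW.fromSpec X)
    (isPullback_lift_snd_of_comp (Spec.map (CommRingCat.ofHom (algebraMap Γ(S, W)
      (hW.primeIdealOf ⟨s, hsW⟩).asIdeal.ResidueField))) hW.fromSpec Y)
    ((Over.pullback (Spec.map (CommRingCat.ofHom (algebraMap Γ(S, W)
      (hW.primeIdealOf ⟨s, hsW⟩).asIdeal.ResidueField)) ≫ hW.fromSpec)).map f).left
    (isPullback_pullback_map_left_of_comp _ _ f).w (Over.w _) x₁ hx₁r
  rw [← hx₁]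
  exact flat_stalkMap_of_flat_stalkMap_pullback_of_isOpenImmersion hW.fromSpec f x₁ h₁

/-- **Base changes to spectra of fields are base changes of the fibre over the residue field**: if the fibre
`X ×_S Spec κ(s) → Y ×_S Spec κ(s)` of `f` over `κ(s)` is flat then so is the base change along every `t : Spec K → S`
centred at `s` (`t` factors through `Spec κ(s) → S`, Mathlib `Scheme.descResidueField_stalkClosedPointTo_fromSpecResidueField`;
transitivity of base change `isPullback_pullback_map_left_of_comp`; flatness is stable under base change).
[cite: StacksProject, Tag 01JO] [cite: GortzWedhorn2020, Section (4.7) (pp. 107–108)] -/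
theorem flat_pullback_map_of_flat_fibre_residueField {X Y : Over S} (f : X ⟶ Y) {K : Type u} [Field K]
    (t : Spec (.of K) ⟶ S) [Flat ((Over.pullback (S.fromSpecResidueField (t (IsLocalRing.closedPoint K)))).map f).left] :
    Flat ((Over.pullback t).map f).left := by
  have ht := Scheme.descResidueField_stalkClosedPointTo_fromSpecResidueField K S t
  rw [← ht]
  exact MorphismProperty.of_isPullback (P := @Flat)
    (isPullback_pullback_map_left_of_comp (Spec.map (S.descResidueField (Scheme.stalkClosedPointTo t)))
      (S.fromSpecResidueField (t (IsLocalRing.closedPoint K))) f).flip inferInstance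

/-- **Critère de platitude par fibres, printed form** ([EGAIV3] Thm. 11.3.10; [StacksProject] Tag 039D (1)): with `f : X → Y`
over `S` as above (`Y` lft, `X` flat lfp) and `s ∈ S`, if the fibre `f_s : X ×_S Spec κ(s) → Y ×_S Spec κ(s)` is flat then
the stalk map of `f` is flat at every point of `X` over `s`. [cite: EGAIV3, Thm. 11.3.10] [cite: StacksProject, Tag 05UV] -/
theorem flat_stalkMap_of_flat_fibre_residueField {X Y : Over S} (f : X ⟶ Y)
    [LocallyOfFiniteType Y.hom] [LocallyOfFinitePresentation X.hom] [Flat X.hom] (s : S)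
    [Flat ((Over.pullback (S.fromSpecResidueField s)).map f).left]
    (x : X.left) (hx : X.hom x = s) : (f.left.stalkMap x).hom.Flat := by
  refine flat_stalkMap_of_flat_fibre f s (fun K _ t ht => ?_) x hx
  subst ht
  exact flat_pullback_map_of_flat_fibre_residueField f t

/-! ## §3 All fibres: flatness of `f` -/

/-- **`f` is flat if all its base changes to spectra of fields are flat** ([StacksProject] Tag 039E; for `f : X → Y` over
`S` with `Y` lft and `X` flat lfp over `S`): flatness is stalkwise (Mathlib `Flat.of_stalkMap`) and §2 applies at every
point. [cite: EGAIV3, Thm. 11.3.10] [cite: StacksProject, Tag 05UV] -/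
theorem flat_of_forall_flat_pullback_Spec_field {X Y : Over S} (f : X ⟶ Y)
    [LocallyOfFiniteType Y.hom] [LocallyOfFinitePresentation X.hom] [Flat X.hom]
    (hfib : ∀ (K : Type u) [Field K] (t : Spec (.of K) ⟶ S), Flat ((Over.pullback t).map f).left) :
    Flat f.left :=
  Flat.of_stalkMap _ fun x => flat_stalkMap_of_flat_fibre f (X.hom x) (fun K _ t _ => hfib K t) x rfl

/-- **`f` is flat if all its fibres over the residue fields of `S` are flat** ([StacksProject] Tag 039E; [EGAIV3] 11.3.10;
`Y` lft, `X` flat lfp over `S`). [cite: EGAIV3, Thm. 11.3.10] [cite: StacksProject, Tag 05UV] -/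
theorem flat_of_forall_flat_fibre_residueField {X Y : Over S} (f : X ⟶ Y)
    [LocallyOfFiniteType Y.hom] [LocallyOfFinitePresentation X.hom] [Flat X.hom]
    (hfib : ∀ s : S, Flat ((Over.pullback (S.fromSpecResidueField s)).map f).left) :
    Flat f.left :=
  Flat.of_stalkMap _ fun x =>
    haveI := hfib (X.hom x)
    flat_stalkMap_of_flat_fibre_residueField f (X.hom x) x rfl

end GeneralBase

end Literature.AlgebraicGeometry.Morphisms

end
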